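import Summits.QuantumFields.YangMills.Theorems.AlphaInputsT3ACHistories
import Literature.MathematicalPhysics.QuantumFieldTheory.Balaban1983to89.B12ContinuousTransportInvariance
import HarnessLib

/-!
# `AlphaInputsT3AC` — THE BRIDGE, PART 4: `EnvelopeRegular` FOR THE ASSEMBLED DATUM BELOW THE TOP LEVEL — integrability of `low_j`/`up_j`
# (part 2) plus POSITIVITY of the small-field mass `0 < ∫ low_j` (here), `j < K`

Lane `pub-balaban3d`, seat alpha-1 (LINE 2 of `defn-AlphaInputsT3AC`, route `UnitScaleTilt`).  The interface's `T3AlphaInputsAC.EnvelopeRegular D K j`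
asks `Integrable low_j ∧ Integrable up_j ∧ 0 < ∫ low_j dW`.  For `D := AlphaInputsT3AC.Of.dataT3 …` the first two are
`dataT3_integrable_low/_up` (part 2, from the step-`j` (α) rows, `j + 1 ≤ K`); the third is proved here WITHOUT any (α) row beyond those:
`low_j = χ_j·exp(…)` is `> 0` on the window `{W | PlaqSmall (θBal (K − j)) W}` (`dataT3_low_pos_of_plaqSmall`, part 3), the window is OPEN
(`isOpen_setOf_plaqSmall_SU2`, finitely many strict inequalities of continuous functions) and NON-EMPTY (the identity field, `θBal > 0`), and
product Haar measure on `SU(2)`-valued fields charges non-empty open sets (tree `B12ContinuousTransportInvariance.isOpenPosMeasure_fieldMeasure_SU`).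
Main: `AlphaInputsT3AC.Of.dataT3_envelopeRegular (hj : j + 1 ≤ K) : EnvelopeRegular (h.dataT3 γ hγ hγ1 π) K j`.  NOT here: the top level `j = K`
(no step row there, finding F-α1-4).  CONDITIONAL on the package; nothing of [Balaban1985UV3] is asserted.

References: T. Bałaban, Commun. Math. Phys. 102 (1985) 255–275 [Balaban1985UV3], (41) p.266, (47) p.267; Commun. Math. Phys. 98 (1985) 17–51
[Balaban1985Averaging], (10) p.19.
-/

set_option autoImplicit false

noncomputable section

namespace Summit.QuantumFields.YangMills.Theorems

open MeasureTheory
open Literature.MathematicalPhysics.QuantumFieldTheory.Balaban1983to89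
open Literature.MathematicalPhysics.QuantumFieldTheory.Balaban1983to89.T3ContinuumYM3Torus
open Literature.MathematicalPhysics.QuantumFieldTheory.Balaban1983to89.T3UnitLawDensityEML (ℰp)
open Literature.MathematicalPhysics.QuantumFieldTheory.Balaban1983to89.T3UnitScaleTilt (θBal)
open Literature.MathematicalPhysics.QuantumFieldTheory.Balaban1983to89.T3AlphaInputsAC
open Literature.MathematicalPhysics.QuantumFieldTheory.Balaban1983to89.B12ContinuousTransportInvariance (isOpenPosMeasure_fieldMeasure_SU)
open Literature.MathematicalPhysics.QuantumFieldTheory.Balaban1985CMP102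
open Literature.MathematicalPhysics.QuantumFieldTheory.Balaban1985CMP102.Setting
open Summit.QuantumFields.Balaban3D.Carriers
open Summit.QuantumFields.Balaban3D.Proofs.Primitives
open Summit.QuantumFields.Balaban3D.Proofs.StandardAC
open Summit.QuantumFields.Balaban3D.Proofs.InputsAC

/-! ## §1 The small-field window is open, non-empty and charged by product Haar measure -/

section Window

variable {P : Params} {j : ℕ}

/-- **THE SMALL-FIELD WINDOW `{U | PlaqSmall δ U}` OF `SU(2)`-VALUED FIELDS IS OPEN** (finitely many strict inequalities of continuous
functions of the bond variables; proof adapted from `FibrePositivity.isOpen_setOf_plaqSmall`, restated here to keep this file off the route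
cone). [cite: Balaban1987RG1, (0.18) p.255] -/
theorem isOpen_setOf_plaqSmall_SU2 (δ : ℝ) :
    IsOpen {U : GaugeField P j (Matrix.specialUnitaryGroup (Fin 2) ℂ) | PlaqSmall δ U} := by
  have hd : Continuous (dist1 : Matrix.specialUnitaryGroup (Fin 2) ℂ → ℝ) :=
    UnitaryModel.continuous_opDist1.comp (Literature.MathematicalPhysics.QuantumLattice.continuous_fundamentalRep (Fin 2))
  have hb : ∀ b : PBond P j, Continuous fun U : GaugeField P j (Matrix.specialUnitaryGroup (Fin 2) ℂ) => U b :=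
    fun b => continuous_apply b
  have hp : ∀ p : Plaq P j,
      Continuous fun U : GaugeField P j (Matrix.specialUnitaryGroup (Fin 2) ℂ) => GaugeField.plaqHol U p := by
    intro p
    unfold GaugeField.plaqHol
    exact (((hb _).mul (hb _)).mul (hb _).inv).mul (hb _).inv
  have hset : {U : GaugeField P j (Matrix.specialUnitaryGroup (Fin 2) ℂ) | PlaqSmall δ U} =
      ⋂ p : Plaq P j, {U | dist1 (GaugeField.plaqHol U p) < δ} := by
    ext U
    simp only [PlaqSmall, Set.mem_setOf_eq, Set.mem_iInter]
  rw [hset]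
  exact isOpen_iInter_of_finite fun p => isOpen_lt (hd.comp (hp p)) continuous_const

/-- The identity field lies in every window of positive radius. [folklore] -/
theorem plaqSmall_one {δ : ℝ} (hδ : 0 < δ) :
    PlaqSmall δ (fun _ : PBond P j => (1 : Matrix.specialUnitaryGroup (Fin 2) ℂ)) := by
  intro p
  have h1 : GaugeField.plaqHol (fun _ : PBond P j => (1 : Matrix.specialUnitaryGroup (Fin 2) ℂ)) p = 1 := by
    unfold GaugeField.plaqHol
    simp
  rw [h1, GaugeGroup.dist1_one]
  exact hδ

/-- **PRODUCT HAAR MEASURE CHARGES THE WINDOW**: `0 < dW{W | PlaqSmall δ W}` for `δ > 0` (open, non-empty, `isOpenPosMeasure_fieldMeasure_SU`).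
[cite: Balaban1985Averaging, (10) p.19] -/
theorem fieldMeasure_plaqSmall_pos {δ : ℝ} (hδ : 0 < δ) :
    0 < fieldMeasure P j (Matrix.specialUnitaryGroup (Fin 2) ℂ)
      {U : GaugeField P j (Matrix.specialUnitaryGroup (Fin 2) ℂ) | PlaqSmall δ U} := by
  haveI := isOpenPosMeasure_fieldMeasure_SU 2 P j
  exact (isOpen_setOf_plaqSmall_SU2 δ).measure_pos _ ⟨fun _ => 1, plaqSmall_one hδ⟩

end Window

/-! ## §2 Positivity of the small-field mass and `EnvelopeRegular` for `j < K` -/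

section Envelope

variable {F : T3Family} {𝔠 : AlphaConsts F.L (suGroupModel 2).N} {γ : ℝ} {hγ : 0 < γ} {hγ1' : γ ≤ (min 𝔠.gamma0 1) ^ 2} {K : ℕ}

/-- The route's window radius at a level `j ≤ K` of run `K` is positive: `θBal(K − j) = ε₁(j) = g_j p(g_j) > 0`
(`InputsAC.eps1_inputOfAC_pos` through `PkgAt.eps1_eq`). [cite: Balaban1985UV3, (7) p.257] -/
theorem AlphaInputsT3AC.PkgAt.θBal_pos (p : AlphaInputsT3AC.PkgAt F 𝔠 γ hγ hγ1' K) (j : ℕ) (hj : j ≤ K) :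
    0 < θBal F.L γ 𝔠.b₀ 𝔠.p₀ (K - j) := by
  rw [← p.eps1_eq j hj]
  exact eps1_inputOfAC_pos 𝔠.lane p.X p.𝔖 j hj

variable (h : AlphaInputsT3AC.Of F 𝔠) (γ' : ℝ) (hγ' : 0 < γ') (hγ1 : γ' ≤ (min 𝔠.gamma0 1) ^ 2) (π : AlphaInputsT3AC.PolymerT3 F)

/-- **THE SMALL-FIELD MASS IS POSITIVE**: `0 < ∫ low_j dW` for `j < K` — `low_j ≥ 0` everywhere, `> 0` on the charged window
`{PlaqSmall (θBal (K − j))}`, and integrable (`dataT3_integrable_low`). [cite: Balaban1985UV3, (47) p.267] -/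
theorem AlphaInputsT3AC.Of.dataT3_integral_low_pos (K j : ℕ) (hj : j + 1 ≤ K) :
    0 < ∫ W, (h.dataT3 γ' hγ' hγ1 π).low K j W ∂fieldMeasure (F.P K) j (Matrix.specialUnitaryGroup (Fin 2) ℂ) := by
  have hjK : j ≤ K := by omega
  rw [integral_pos_iff_support_of_nonneg_ae (ae_of_all _ fun W => h.dataT3_low_nonneg γ' hγ' hγ1 π K j W)
    (h.dataT3_integrable_low γ' hγ' hγ1 π K j hj)]
  have hθ : 0 < θBal F.L γ' 𝔠.b₀ 𝔠.p₀ (K - j) := (h.pkgAt γ' hγ' hγ1 K).θBal_pos j hjK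
  refine lt_of_lt_of_le (fieldMeasure_plaqSmall_pos (P := F.P K) (j := j) hθ) (measure_mono fun W hW => ?_)
  exact Function.mem_support.mpr (ne_of_gt (h.dataT3_low_pos_of_plaqSmall γ' hγ' hγ1 π K j hjK W hW))

/-- **`EnvelopeRegular` FOR THE ASSEMBLED DATUM AT EVERY LEVEL `j < K`** — the interface's regularity clause: `low_j`, `up_j` integrable and
`0 < ∫ low_j`. [cite: Balaban1985UV3, (41) p.266 and (47) p.267] -/
theorem AlphaInputsT3AC.Of.dataT3_envelopeRegular (K j : ℕ) (hj : j + 1 ≤ K) :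
    EnvelopeRegular (h.dataT3 γ' hγ' hγ1 π) K j :=
  ⟨h.dataT3_integrable_low γ' hγ' hγ1 π K j hj, h.dataT3_integrable_up γ' hγ' hγ1 π K j hj,
    h.dataT3_integral_low_pos γ' hγ' hγ1 π K j hj⟩

/-- The package's sandwich-and-regularity clause in the interface's bundled form, for `j < K`: `Ineq41AE ∧ Ineq47AE ∧ EnvelopeRegular`.
[cite: Balaban1985UV3, Thm 2 p.272] -/
theorem AlphaInputsT3AC.Of.dataT3_sandwich_regular (K j : ℕ) (hj : j + 1 ≤ K) :
    Ineq41AE (h.dataT3 γ' hγ' hγ1 π) K j ∧ Ineq47AE (h.dataT3 γ' hγ' hγ1 π) K j ∧ EnvelopeRegular (h.dataT3 γ' hγ' hγ1 π) K j :=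
  ⟨h.dataT3_ineq41AE γ' hγ' hγ1 π K j (by omega), h.dataT3_ineq47AE γ' hγ' hγ1 π K j (by omega),
    h.dataT3_envelopeRegular γ' hγ' hγ1 π K j hj⟩

end Envelope

end Summit.QuantumFields.YangMills.Theorems

end
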